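import Mathlib
import HarnessLib
import Summits.NavierStokesRegularity.NavierStokesRegularity.Theorems.PoloidalWindowDoorPoloidalWindowRigidityTimeShearLiminf
import Summits.NavierStokesRegularity.NavierStokesRegularity.Theorems.PoloidalWindowDoorPoloidalWindowRigidityHorizontalFlatPast
import Summits.NavierStokesRegularity.NavierStokesRegularity.Theorems.PoloidalWindowDoorPoloidalWindowRigidityK2OfLrcSpatial

/-!
# Route `PoloidalWindowDoor`, crux `PoloidalWindowRigidity` (K2, stmt-NavierStokesRegularity-19708), line `lrc-jet` —
# THE STRATUM (TV) «TIME-DEPENDENT PROPORTIONAL SHEAR» IS EMPTY IN THE CLASS (no bound on the slope), and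
# `K2 ⇐ stub_lrcSpatial` ALONE

Cell ns-regularity-ideate, seat ns-poloidal-K2-p2 gen 3 (stub-worker under the K2 lead ns-poloidal-K2-p1 g4; file landed
`--supports stmt-NavierStokesRegularity-19708` as a helper).  Assembly of three tree theorems, no new analysis:

* this seat's `…TimeShearLiminf.nonflatLiouville_of_timeShear_liminf` (= the registered stub `stub_tvLiminf`, p525351):
  all-slices proportional shear with `μ < 0` analytic and `μ ≥ −M` along SOME sequence `τ → −∞` ⇒ not backward-singular;
* the K2 lead's `…HorizontalFlatPast.nonflatLiouville_of_timeShear_unbounded` (p519353): `|μ(τ)| → ∞` ⇒ not backward-singular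
  (zoom-out: the vertical velocity becomes horizontally flat in scale-invariant size);
* ns-poloidal-K2-p3 g4's `…K2OfLrcSpatial.nonflatLiouville_of_lrc_spatial` (p518127) and
  `…TimeShearPressure.timeShear_normalForm` (p517107).

Results:
* `tv_holds` — **the hypothesis `hTV` of `nonflatLiouville_of_lrc_spatial` is a THEOREM**: for a profile of the route's
  Type-I class, poloidal along `e₃`, every negative real-analytic slope function `μ` with `∂₂v_b(s,·) ≡ μ(s)∂_b v₂(s,·)`
  on all slices gives `¬ IsBackwardSingularPoint v 0` (the dichotomy `liminf |μ| < ∞` / `|μ| → ∞`; non-constancy unused);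
* `nonflatLiouville_of_local_timeShear` — **(TV) IS EMPTY**: if the shear slope is a function of time alone on SOME
  nonempty open space–time set (`∂₂v_b(z) = m(z.1) ∂_b v₂(z)` on `W`), then `v` is not backward-singular
  (`timeShear_normalForm` + `tv_holds`);
* `nonflatLiouville_of_lrcSpatial` — **`K2 ⇐ LRC″ with spatial pins`**: class + poloidal + `hLRC` (verbatim the
  hypothesis of `nonflatLiouville_of_lrc_spatial`, i.e. the registered stub `stub_lrcSpatial` instantiated at `v`)
  ⇒ `¬ IsBackwardSingularPoint v 0`.  So the skeleton `Lines/lrc_jet.lean` may drop `tv_of_stubs`: the crux hinges on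
  `stub_lrcSpatial` alone.

WHAT THIS IS NOT: not a claim about Navier–Stokes regularity and not LRC″ — `stub_lrcSpatial` (the jet certificate line)
remains the one open stub of crux K2 (bears_on LADDER-NS N0, rung N0-LocalTubeDoorPoloidal).
-/

noncomputable section

-- the summit and its single sub-problem share the name (CONVENTIONS §1), as in every Theorems file
set_option linter.dupNamespace false

namespace Summit.NavierStokesRegularity.NavierStokesRegularity.Theorems.PoloidalWindowDoorPoloidalWindowRigidityTimeShearClosed

open Set Function Filter Topology Metric
open scoped RealInnerProductSpace InnerProductSpace
open Literature.Analysis Literature.Analysis.FluidPDE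
open Summit.NavierStokesRegularity.NavierStokesRegularity.Theorems.PoloidalWindowDoorPoloidalWindowRigidityFlat
open Summit.NavierStokesRegularity.NavierStokesRegularity.Theorems.PoloidalWindowDoorPoloidalWindowRigidityK2OfLrcSlope
open Summit.NavierStokesRegularity.NavierStokesRegularity.Theorems.PoloidalWindowDoorPoloidalWindowRigidityTimeShearPressure
open Summit.NavierStokesRegularity.NavierStokesRegularity.Theorems.PoloidalWindowDoorPoloidalWindowRigidityTimeShearLiminf
open Summit.NavierStokesRegularity.NavierStokesRegularity.Theorems.PoloidalWindowDoorPoloidalWindowRigidityHorizontalFlatPast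
open Summit.NavierStokesRegularity.NavierStokesRegularity.Theorems.PoloidalWindowDoorPoloidalWindowRigidityK2OfLrcSpatial

variable {C : ℝ} {v : ℝ → EuclideanSpace ℝ (Fin 3) → EuclideanSpace ℝ (Fin 3)}

section Class

variable (hrate : HasTypeITimeDecay C v) (hcont : ContinuousOn (uncurry v) (Iio (0 : ℝ) ×ˢ univ))
  (hmild : ∀ s t : ℝ, s < t → t < 0 → ∀ x,
    v t x = UnboundedOperators.heatExtension (v s) (t - s) x - oseenDuhamel 1 s v v t x)
  (hdiv : ∀ t < 0, VectorCalculus.IsDivFree (v t))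
  (hpol : ∀ s < 0, ∀ y, ⟪curl (v s) y, EuclideanSpace.single 2 1⟫_ℝ = 0)

include hrate hcont hmild hdiv hpol

/-- **ALL-SLICES PROPORTIONAL SHEAR WITH A NEGATIVE ANALYTIC SLOPE FUNCTION ⇒ not backward-singular** — no bound on the
slope: either `μ ≥ −M` along some sequence `τ → −∞` (this seat's `nonflatLiouville_of_timeShear_liminf`) or `|μ(τ)| → ∞`
(the K2 lead's `nonflatLiouville_of_timeShear_unbounded`). -/
theorem nonflatLiouville_of_timeShear_analytic {μ : ℝ → ℝ} (hμneg : ∀ s < 0, μ s < 0)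
    (hμa : ∀ s < 0, AnalyticAt ℝ μ s)
    (hslope : ∀ s < 0, ∀ y, ∀ b : Fin 3, b ≠ 2 →
      fderiv ℝ (v s) y (EuclideanSpace.single 2 1) b = μ s * fderiv ℝ (v s) y (EuclideanSpace.single b 1) 2) :
    ¬ IsBackwardSingularPoint v 0 := by
  by_cases hB : ∃ M : ℝ, ∀ T : ℝ, ∃ τ < T, -M ≤ μ τ
  · obtain ⟨M, hM⟩ := hB
    exact nonflatLiouville_of_timeShear_liminf hrate hcont hmild hdiv hpol hμneg hslope hμa hM
  · push Not at hB
    refine nonflatLiouville_of_timeShear_unbounded hrate hcont hmild hdiv hpol hslope fun M => ?_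
    obtain ⟨T, hT⟩ := hB M
    refine ⟨T, fun τ hτ => ?_⟩
    have h1 : μ τ < -M := hT τ hτ
    have h2 : M < -μ τ := by linarith
    exact h2.le.trans (neg_le_abs (μ τ))

/-- **`hTV` of `…K2OfLrcSpatial.nonflatLiouville_of_lrc_spatial` is a theorem** (verbatim its hypothesis shape; the
non-constancy clause is not needed). -/
theorem tv_holds :
    ∀ μ : ℝ → ℝ, (∀ s < 0, μ s < 0) → (∀ s < 0, AnalyticAt ℝ μ s) →
      (∃ s₁ s₂ : ℝ, s₁ < 0 ∧ s₂ < 0 ∧ μ s₁ ≠ μ s₂) →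
      (∀ s < 0, ∀ y, ∀ b : Fin 3, b ≠ 2 →
        fderiv ℝ (v s) y (EuclideanSpace.single 2 1) b = μ s * fderiv ℝ (v s) y (EuclideanSpace.single b 1) 2) →
      ¬ IsBackwardSingularPoint v 0 :=
  fun _ hμneg hμa _ hslope => nonflatLiouville_of_timeShear_analytic hrate hcont hmild hdiv hpol hμneg hμa hslope

/-- **THE STRATUM (TV) IS EMPTY IN THE CLASS.**  A profile of the route's Type-I class, poloidal along `e₃`, whose shear
slope is a function of TIME ALONE on some nonempty open space–time subset of the backward slab
(`∂₂v_b(z) = m(z.1)·∂_b v₂(z)` for `z ∈ W`, `b = 0,1`), is not backward-singular: by K2-p3's `timeShear_normalForm`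
either `v ≡ 0` or every slice is proportional-shear with one negative analytic slope function, and then
`nonflatLiouville_of_timeShear_analytic` ends.  This is exactly the complement of the pin hypothesis of `stub_lrcSpatial`. -/
theorem nonflatLiouville_of_local_timeShear {W : Set (ℝ × EuclideanSpace ℝ (Fin 3))} (hW : IsOpen W) (hWne : W.Nonempty)
    (hWs : W ⊆ Iio (0 : ℝ) ×ˢ univ) {m : ℝ → ℝ}
    (h : ∀ z ∈ W, ∀ b : Fin 3, b ≠ 2 →
      fderiv ℝ (v z.1) z.2 (EuclideanSpace.single 2 1) b = m z.1 * fderiv ℝ (v z.1) z.2 (EuclideanSpace.single b 1) 2) :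
    ¬ IsBackwardSingularPoint v 0 := by
  rcases timeShear_normalForm hrate hcont hmild hdiv hpol hW hWne hWs h with hzero | ⟨μ, hμneg, hμa, hslope⟩
  · exact not_backwardSingular_of_zero hzero
  · exact nonflatLiouville_of_timeShear_analytic hrate hcont hmild hdiv hpol hμneg hμa hslope

/-- **`K2 ⇐ LRC″ WITH SPATIAL PINS` (class form, (TV) discharged).**  For a profile of the route's Type-I class,
poloidal along `e₃`: if on every nonempty open space–time set `W` of the backward slab on which the profile is
non-degenerate (`curl v ≠ 0`, `∇_h v₂ ≠ 0`, `∂₂v_h ≠ 0`) and on which the shear slope is not a function of time alone on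
any nonempty open subset, some slice carries a translation or rotation germ of the vorticity on a nonempty open set
(`hLRC` = the registered stub `stub_lrcSpatial` at `v`), then `v` is not backward-singular.  Proof: K2-p3's
`nonflatLiouville_of_lrc_spatial` with `hTV := tv_holds`. -/
theorem nonflatLiouville_of_lrcSpatial
    (hLRC : ∀ W : Set (ℝ × EuclideanSpace ℝ (Fin 3)), IsOpen W → W.Nonempty → W ⊆ Iio (0 : ℝ) ×ˢ univ →
      (∀ z ∈ W, curl (v z.1) z.2 ≠ 0 ∧
        (fderiv ℝ (v z.1) z.2 (EuclideanSpace.single 0 1) 2 ≠ 0 ∨ fderiv ℝ (v z.1) z.2 (EuclideanSpace.single 1 1) 2 ≠ 0) ∧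
        (fderiv ℝ (v z.1) z.2 (EuclideanSpace.single 2 1) 0 ≠ 0 ∨ fderiv ℝ (v z.1) z.2 (EuclideanSpace.single 2 1) 1 ≠ 0)) →
      (∀ m : ℝ → ℝ, ∀ W₁ : Set (ℝ × EuclideanSpace ℝ (Fin 3)), W₁ ⊆ W → IsOpen W₁ → W₁.Nonempty →
        ∃ z ∈ W₁, ∃ b : Fin 3, b ≠ 2 ∧
          fderiv ℝ (v z.1) z.2 (EuclideanSpace.single 2 1) b ≠ m z.1 * fderiv ℝ (v z.1) z.2 (EuclideanSpace.single b 1) 2) →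
      ∃ s : ℝ, s < 0 ∧ ∃ U : Set (EuclideanSpace ℝ (Fin 3)), IsOpen U ∧ U.Nonempty ∧
        ((∃ e : EuclideanSpace ℝ (Fin 3), e ≠ 0 ∧ ∀ y ∈ U, fderiv ℝ (curl (v s)) y e = 0) ∨
         (∃ c : EuclideanSpace ℝ (Fin 3), ∀ y ∈ U,
            rotGen (curl (v s) y) = fderiv ℝ (curl (v s)) y (rotGen (y - c))))) :
    ¬ IsBackwardSingularPoint v 0 :=
  nonflatLiouville_of_lrc_spatial hrate hcont hmild hdiv hpol hLRC (tv_holds hrate hcont hmild hdiv hpol)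

end Class

/-- **The crux from `stub_lrcSpatial` ALONE (fully quantified, skeleton-ready).**  For every profile of the route's
Type-I class that is poloidal along `e₃`: `hLRC` (the registered stub `stub_lrcSpatial`, instantiated) ⇒ not
backward-singular.  The K2 lead's skeleton `Lines/lrc_jet.lean` v3 may take
`sliceSharpNonflatLiouville_of_lrcJet := … (lrcSpatial_closes_tv C v … (stub_lrcSpatial C v …))`. -/
theorem lrcSpatial_closes_tv :
    ∀ (C : ℝ) (v : ℝ → EuclideanSpace ℝ (Fin 3) → EuclideanSpace ℝ (Fin 3)),
      HasTypeITimeDecay C v →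
      ContinuousOn (Function.uncurry v) (Set.Iio (0 : ℝ) ×ˢ Set.univ) →
      (∀ s t : ℝ, s < t → t < 0 → ∀ x, v t x =
        UnboundedOperators.heatExtension (v s) (t - s) x - oseenDuhamel 1 s v v t x) →
      (∀ t < 0, VectorCalculus.IsDivFree (v t)) →
      (∀ s < 0, ∀ y, ⟪curl (v s) y, EuclideanSpace.single 2 1⟫_ℝ = 0) →
      (∀ W : Set (ℝ × EuclideanSpace ℝ (Fin 3)), IsOpen W → W.Nonempty → W ⊆ Set.Iio (0 : ℝ) ×ˢ Set.univ →
        (∀ z ∈ W, curl (v z.1) z.2 ≠ 0 ∧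
          (fderiv ℝ (v z.1) z.2 (EuclideanSpace.single 0 1) 2 ≠ 0 ∨ fderiv ℝ (v z.1) z.2 (EuclideanSpace.single 1 1) 2 ≠ 0) ∧
          (fderiv ℝ (v z.1) z.2 (EuclideanSpace.single 2 1) 0 ≠ 0 ∨ fderiv ℝ (v z.1) z.2 (EuclideanSpace.single 2 1) 1 ≠ 0)) →
        (∀ m : ℝ → ℝ, ∀ W₁ : Set (ℝ × EuclideanSpace ℝ (Fin 3)), W₁ ⊆ W → IsOpen W₁ → W₁.Nonempty →
          ∃ z ∈ W₁, ∃ b : Fin 3, b ≠ 2 ∧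
            fderiv ℝ (v z.1) z.2 (EuclideanSpace.single 2 1) b ≠ m z.1 * fderiv ℝ (v z.1) z.2 (EuclideanSpace.single b 1) 2) →
        ∃ s : ℝ, s < 0 ∧ ∃ U : Set (EuclideanSpace ℝ (Fin 3)), IsOpen U ∧ U.Nonempty ∧
          ((∃ e : EuclideanSpace ℝ (Fin 3), e ≠ 0 ∧ ∀ y ∈ U, fderiv ℝ (curl (v s)) y e = 0) ∨
           (∃ c : EuclideanSpace ℝ (Fin 3), ∀ y ∈ U,
              rotGen (curl (v s) y) = fderiv ℝ (curl (v s)) y (rotGen (y - c))))) →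
      ¬ IsBackwardSingularPoint v 0 :=
  fun _ _ hrate hcont hmild hdiv hpol hLRC => nonflatLiouville_of_lrcSpatial hrate hcont hmild hdiv hpol hLRC

end Summit.NavierStokesRegularity.NavierStokesRegularity.Theorems.PoloidalWindowDoorPoloidalWindowRigidityTimeShearClosed

end
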